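import Summits.BirchSwinnertonDyer.BirchSwinnertonDyer.Theorems.ManinLocalTwoThreePositionLawsOfStevensLedger
import HarnessLib

/-!
# The C3 line `kato_shift_three` v17 BY NAME, as tree theorems: C3 ⟸ F-es-18 ∧ E-an-57 ∧ LAW₃♮ ∧ T3III ∧ T3W ∧ RES₃♭,
# (the E-an-99 form is p648978's `…_of_kernelIsMu_of_coprimeIsolated`)

Summit `BirchSwinnertonDyer`, route `ManinLocalTwoThree` (cell bsd-f2-manin), deciding crux C3 `ManinPrimeToThreeAtNine`
(stmt-BirchSwinnertonDyer-22968), line `kato_shift_three`, skeleton v17 (lead p1 gen 7, registered on the crux item; HOME/p1/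
Line-kato-shift-three-v17.lean): six stubs, ALL BY NAME — F-es-18 `kato_neron_isIntegral_twistedSymbolSum_of_additive_three_polar`
(Kato, Literature, statement-only), E-an-57 `CuspidalKummerCubeRepresentativeAtNine`, LAW₃♮ `CuspidalKummerCubeExponentLawNonBlind`, the
two Kodaira POSITION LAWS T3III `OptimalRationalThreeTorsionIsTypeIII` (an E-an-112) and T3W `OptimalRationalThreeTorsionWildPosition`
(typer p653781), and RES₃♭ `NoRationalThreeTorsionCoprimeIsolatedResidual`.  This file records the v17 composition as ONE tree theorem
(`maninPrimeToThreeAtNine_of_katoFact_of_cuspidalKummerCube_of_nonBlindLaw_of_positionLaws_of_coprimeIsolated`: NB₃^V from the two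
position laws by `noAscendingThreeTorsionOptimal_iff_positionLaws` p653293 under the crux's own modularity binder, then the v14
composition `…_of_noAscending_of_coprimeIsolated` p648978); the E-an-99 variant is p648978's `…_of_kernelIsMu_of_coprimeIsolated` (same
statement, not restated here; E-an-99 ⟹ T3III ∧ T3W is `positionLaws_of_optimalAscendingThreeKernelIsMu`, p654034).

HONEST FRAMING: CONDITIONAL reductions; every hypothesis is an OPEN law or an unformalised printed theorem (F-es-18); C3, Manin's
conjecture and BSD are NOT proved.  No definitions, no named facts, no sorry.
-/

set_option linter.dupNamespace false
set_option autoImplicit false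

noncomputable section

open scoped Classical

open WeierstrassCurve Literature.NumberTheory.EllipticCurves Literature.NumberTheory.EllipticCurves.ModularForms
  Summit.BirchSwinnertonDyer.Rank1Residual.ManinAdditive
  Summit.BirchSwinnertonDyer.Rank1Residual.ManinAdditive.CuspidalKummer
  Summit.BirchSwinnertonDyer.Rank1Residual.ManinAdditive.CuspidalKummerThree
  Summit.BirchSwinnertonDyer.Rank1Residual.ManinAdditive.ThreeIsogenyKernel

namespace Summit.BirchSwinnertonDyer.BirchSwinnertonDyer.Theorems.ManinLocalTwoThree

/-- **NB₃^V ⟸ T3III ∧ T3W BY NAME, given modularity** (`noAscendingThreeTorsionOptimal_iff_positionLaws`, p653293, with the typer's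
leaves p653781 on the right). [cite: DiamondShurman2005, Thm. 5.8.2] -/
theorem noAscendingThreeTorsionOptimal_of_positionLaws (hnf : exists_isNewformOf) (h112 : OptimalRationalThreeTorsionIsTypeIII)
    (hW : OptimalRationalThreeTorsionWildPosition) : NoAscendingThreeTorsionOptimal :=
  (noAscendingThreeTorsionOptimal_iff_positionLaws hnf).mpr ⟨h112, hW⟩

/-- **T3III ∧ T3W ⟸ NB₃^V BY NAME** (no modularity needed in this direction). [cite: SilvermanATAEC1994, IV.9.4 Table 4.1] -/
theorem positionLaws_of_noAscendingThreeTorsionOptimal (h : NoAscendingThreeTorsionOptimal) :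
    OptimalRationalThreeTorsionIsTypeIII ∧ OptimalRationalThreeTorsionWildPosition :=
  ⟨typeIIILaw_of_noAscendingThreeTorsionOptimal h, wildPositionLaw_of_noAscendingThreeTorsionOptimal h⟩

/-- **T3III ∧ T3W ⟸ E-an-99 ASCμ₃ BY NAME** (`positionLaws_of_optimalAscendingThreeKernelIsMu`, p654034, with named conclusions).
[cite: Vatsal2005, Conj. 1.9 (shape only: the laws are the cell's E-an-99/100, implied by Stevens' Conjecture II)] -/
theorem positionLaws_of_optimalAscendingThreeKernelIsMu' (h99 : OptimalAscendingThreeKernelIsMu) :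
    OptimalRationalThreeTorsionIsTypeIII ∧ OptimalRationalThreeTorsionWildPosition :=
  positionLaws_of_optimalAscendingThreeKernelIsMu h99

/-- **The C3 line `kato_shift_three` v17 BY NAME: C3 `ManinPrimeToThreeAtNine` ⟸ F-es-18 ∧ E-an-57 ∧ LAW₃♮ ∧ T3III ∧ T3W ∧ RES₃♭.**
Modularity is the crux's own fourth binder; NB₃^V is recombined from the two position laws and fed to the v14 composition.
CONDITIONAL reduction; nothing about BSD or Manin's conjecture is proved.
[cite: Kato2004Asterisque, Thm. 6.6 (1) (shape of the input F-es-18 only)] -/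
theorem maninPrimeToThreeAtNine_of_katoFact_of_cuspidalKummerCube_of_nonBlindLaw_of_positionLaws_of_coprimeIsolated
    (h₁ : kato_neron_isIntegral_twistedSymbolSum_of_additive_three_polar) (h₂ : CuspidalKummerCubeRepresentativeAtNine)
    (h₄ : CuspidalKummerCubeExponentLawNonBlind) (h112 : OptimalRationalThreeTorsionIsTypeIII)
    (hW : OptimalRationalThreeTorsionWildPosition) (h₅ : NoRationalThreeTorsionCoprimeIsolatedResidual) :
    Summit.BirchSwinnertonDyer.BirchSwinnertonDyer.Theses.ManinLocalTwoThree.ManinPrimeToThreeAtNine := by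
  intro hM hAU hC hnf
  exact maninPrimeToThreeAtNine_of_katoFact_of_cuspidalKummerCube_of_nonBlindLaw_of_noAscending_of_coprimeIsolated h₁ h₂ h₄
    (noAscendingThreeTorsionOptimal_of_positionLaws hnf h112 hW) h₅ hM hAU hC hnf

end Summit.BirchSwinnertonDyer.BirchSwinnertonDyer.Theorems.ManinLocalTwoThree

end
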